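import Summits.BirchSwinnertonDyer.BirchSwinnertonDyer.Theses.ShadowIsolation
import Summits.BirchSwinnertonDyer.BirchSwinnertonDyer.Theorems.ShadowIsolationIsolationOfAccidentalZerosStubDepthRigidity
import Summits.BirchSwinnertonDyer.BirchSwinnertonDyer.Theorems.ShadowIsolationIsolationOfAccidentalZerosStubRationalSectorFinite
import HarnessLib

/-!
# BirchSwinnertonDyer / ShadowIsolation — crux `IsolationOfAccidentalZeros` (stmt-BirchSwinnertonDyer-15786),
# line `birth`/`registered`, stub **T** `stub_transfer`: the compactness cut as a tree theorem

The crux `IsolationOfAccidentalZeros` of route `ShadowIsolation` says: for `W/ℚ` globally minimal elliptic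
and `p ≥ 5` good ordinary with `E[p]` irreducible there is a depth `n₀` beyond which there is NO
*depth-`n` shadow* `(M, g)` — `M` squarefree coprime to `p·N_W`, `g ∈ S₂(Γ₀(N_W·M))` a newform whose
`q`-expansion is not `(aₘ(W))ₘ`, with Fricke eigenvalue `−1` (even sign), Hecke eigenvalues `a_ℓ(g)`
(`ℓ ∤ N_W·M`) congruent to `a_ℓ(W)` modulo `pⁿ` through a ring homomorphism `φ : R → ℤ/pⁿ` on a subring
`R ⊆ ℂ` containing them, and an entire continuation of `L(g, s)` vanishing at `s = 1`.

This file lands the COMPOSITION of the line `birth` (skeleton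
`Cruxes/IsolationOfAccidentalZeros/Lines/birth.lean`) as the registered transfer stub `stub_transfer`:

  modularity (`exists_isNewformOf`) → Eichler–Shimura (`eichlerShimuraConstruction`) →
  deep-congruence finiteness (`DeepCongruenceFinite`) → F_irr (finiteness of the IRRATIONAL depth-`n`
  shadows at ONE depth `n`) → `IsolationOfAccidentalZeros`.

The two theorem-level stubs of the line are already tree theorems and are USED here:
* K · `stub_depthRigidity` (`…StubDepthRigidity.lean`): given modularity, a fixed newform whose
  `q`-expansion differs from `(aₘ(W))ₘ` is congruent to `W` only to bounded depth;
* F_rat · `stub_rationalSectorFinite` (`…StubRationalSectorFinite.lean`): given Eichler–Shimura and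
  `DeepCongruenceFinite`, the depth-`2` congruent pairs `(M, g)` with INTEGRAL `q`-expansion form a finite
  set.

Proof (finite-supremum / compactness cut). Write `A_n` for the set of depth-`n` shadows; `A_n ⊆ A_m` for
`m ≤ n` (reduce `φ` modulo `p^m`). At a depth `n₁ ≥ n_rat, n_irr` the set `A_{n₁}` is finite: a member with
integral `q`-expansion lies in the finite set of F_rat, any other member in the finite set of F_irr. Each
member of `A_{n₁}` dies at some depth by K. Beyond the maximum of `n₁` and these finitely many death depths
nothing survives, since a deeper shadow restricts to a member of `A_{n₁}` still alive at that depth.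

No definition is introduced: the shadow sets are bound locally (`obtain ⟨A, hA⟩ : ∃ A, ∀ n x, x ∈ A n ↔ …`).
-/

set_option linter.dupNamespace false

noncomputable section

namespace Summit.BirchSwinnertonDyer.BirchSwinnertonDyer.Theorems

open scoped MatrixGroups ModularForm
open CongruenceSubgroup UpperHalfPlane
open Literature.NumberTheory.EllipticCurves Literature.NumberTheory.EllipticCurves.ModularForms

/-- **T · `stub_transfer`** — the compactness cut of line `birth` for the crux
`ShadowIsolation.IsolationOfAccidentalZeros`, as a theorem: modularity (`exists_isNewformOf`, BCDT 2001),
the Eichler–Shimura construction (`eichlerShimuraConstruction`, Knapp 11.74 + Carayol), the finiteness of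
deep congruences to a fixed elliptic curve (`DeepCongruenceFinite`, Faltings 1983 Satz 7 + Carayol 1994)
and the finiteness at ONE depth of the IRRATIONAL shadows (the open core F_irr of the line, taken as the
fourth hypothesis, verbatim the registered stub `stub_irrationalShadowsFinite`) together imply
`IsolationOfAccidentalZeros`. Uses the landed stubs `stub_depthRigidity` (K) and
`stub_rationalSectorFinite` (F_rat). [folklore] -/
theorem stub_transfer : exists_isNewformOf → eichlerShimuraConstruction → DeepCongruenceFinite →
    (∀ (W : WeierstrassCurve ℚ) [W.IsElliptic] [W.IsGloballyMinimal] (p : ℕ) [Fact p.Prime],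
      5 ≤ p → W.HasGoodReductionAtPrime p → ¬ (p : ℤ) ∣ W.frobeniusTrace p →
      W.HasIrreducibleModPGaloisRep p →
      ∃ n : ℕ, Set.Finite {x : Σ M : ℕ, CuspForm (CongruenceSubgroup.Gamma0 (W.conductorNorm ℤ * M)) 2 |
        ∃ (_ : NeZero (W.conductorNorm ℤ * x.1)) (R : Subring ℂ) (φ : R →+* ZMod (p ^ n)) (hR : ∀ ℓ : ℕ, ℓ.Prime → ¬ ℓ ∣ W.conductorNorm ℤ * x.1 → heckeEigenvalue x.2 ℓ ∈ R), ¬ (∀ m : ℕ, ∃ a : ℤ, (qExpansion 1 ⇑(x.2)).coeff m = (a : ℂ)) ∧ Squarefree x.1 ∧ Nat.Coprime x.1 (p * W.conductorNorm ℤ) ∧ IsNewform0 x.2 ∧ (∃ m : ℕ, (qExpansion 1 ⇑(x.2)).coeff m ≠ ((W.LFunction m : ℤ) : ℂ)) ∧ cuspHeckeOperatorₗ (CongruenceSubgroup.Gamma0 (W.conductorNorm ℤ * x.1)) 2 (slToGLPos ModularGroup.S * diagGL ((W.conductorNorm ℤ * x.1 : ℕ) : ℚ) 1 (Nat.cast_pos.mpr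 (NeZero.pos (W.conductorNorm ℤ * x.1))) one_pos) x.2 = -(x.2) ∧ (∀ (ℓ : ℕ) (hℓ : ℓ.Prime) (hℓL : ¬ ℓ ∣ W.conductorNorm ℤ * x.1), φ ⟨heckeEigenvalue x.2 ℓ, hR ℓ hℓ hℓL⟩ = ((W.frobeniusTrace ℓ : ℤ) : ZMod (p ^ n))) ∧ ∃ Λ : ℂ → ℂ, Differentiable ℂ Λ ∧ (∀ s : ℂ, 2 < s.re → Λ s = LSeries (fun m ↦ (qExpansion 1 ⇑(x.2)).coeff m) s) ∧ Λ 1 = 0}) →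
    Summit.BirchSwinnertonDyer.BirchSwinnertonDyer.Theses.ShadowIsolation.IsolationOfAccidentalZeros := by
  intro hMod hES hDC hFi W _ _ p _ h5 hgood hord hirr
  classical
  -- the depth-`n` shadow sets `A n`, bound locally together with their membership characterisation
  obtain ⟨A, hA⟩ : ∃ A : ℕ → Set (Σ M : ℕ, CuspForm (CongruenceSubgroup.Gamma0 (W.conductorNorm ℤ * M)) 2),
      ∀ (n : ℕ) (x : Σ M : ℕ, CuspForm (CongruenceSubgroup.Gamma0 (W.conductorNorm ℤ * M)) 2), x ∈ A n ↔
        ∃ (_ : NeZero (W.conductorNorm ℤ * x.1)) (R : Subring ℂ) (φ : R →+* ZMod (p ^ n)) (hR : ∀ ℓ : ℕ, ℓ.Prime → ¬ ℓ ∣ W.conductorNorm ℤ * x.1 → heckeEigenvalue x.2 ℓ ∈ R), Squarefree x.1 ∧ Nat.Coprime x.1 (p * W.conductorNorm ℤ) ∧ IsNewform0 x.2 ∧ (∃ m : ℕ, (qExpansion 1 ⇑(x.2)).coeff m ≠ ((W.LFunction m : ℤ) : ℂ)) ∧ cuspHeckeOperatorₗ (CongruenceSubgroup.Gamma0 (W.conductorNorm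 ℤ * x.1)) 2 (slToGLPos ModularGroup.S * diagGL ((W.conductorNorm ℤ * x.1 : ℕ) : ℚ) 1 (Nat.cast_pos.mpr (NeZero.pos (W.conductorNorm ℤ * x.1))) one_pos) x.2 = -(x.2) ∧ (∀ (ℓ : ℕ) (hℓ : ℓ.Prime) (hℓL : ¬ ℓ ∣ W.conductorNorm ℤ * x.1), φ ⟨heckeEigenvalue x.2 ℓ, hR ℓ hℓ hℓL⟩ = ((W.frobeniusTrace ℓ : ℤ) : ZMod (p ^ n))) ∧ ∃ Λ : ℂ → ℂ, Differentiable ℂ Λ ∧ (∀ s : ℂ, 2 < s.re → Λ s = LSeries (fun m ↦ (qExpansion 1 ⇑(x.2)).coeff m) s) ∧ Λ 1 = 0 :=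
    ⟨fun n ↦ {x | _}, fun _ _ ↦ Iff.rfl⟩
  -- `A n ⊆ A m` for `m ≤ n`: reduce the congruence modulo `p ^ m`
  have anti : ∀ {m n : ℕ}, m ≤ n → A n ⊆ A m := by
    intro m n hmn x hx
    obtain ⟨hM, R, φ, hR, hsq, hcop, hnew, hmis, hfr, hcong, hΛ⟩ := (hA n x).1 hx
    refine (hA m x).2 ⟨hM, R, (ZMod.castHom (pow_dvd_pow p hmn) (ZMod (p ^ m))).comp φ, hR, hsq, hcop,
      hnew, hmis, hfr, ?_, hΛ⟩
    intro ℓ hℓ hℓL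
    rw [RingHom.comp_apply, hcong ℓ hℓ hℓL, map_intCast]
  obtain ⟨nr, hr⟩ := stub_rationalSectorFinite hES hDC W p h5 hgood hord hirr
  obtain ⟨ni, hi⟩ := hFi W p h5 hgood hord hirr
  obtain ⟨n₁, hn₁r, hn₁i⟩ : ∃ n₁ : ℕ, nr ≤ n₁ ∧ ni ≤ n₁ := ⟨max nr ni, le_max_left _ _, le_max_right _ _⟩
  -- (1) `A n₁` is finite: it lies in the union of the two finite sector sets
  have hfin : (A n₁).Finite := by
    refine (hr.union hi).subset ?_
    rintro ⟨M, g⟩ hx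
    obtain ⟨hM₀, -⟩ := (hA n₁ _).1 hx
    haveI := hM₀
    simp only [Set.mem_union, Set.mem_setOf_eq]
    by_cases hrat : (∀ m : ℕ, ∃ a : ℤ, (qExpansion 1 ⇑g).coeff m = (a : ℂ))
    · obtain ⟨hM, R, φ, hR, hsq, hcop, hnew, -, -, hcong, -⟩ := (hA nr _).1 (anti hn₁r hx)
      exact Or.inl ⟨hM, R, φ, hR, hrat, hsq, hcop, hnew, hcong⟩
    · obtain ⟨hM, R, φ, hR, hsq, hcop, hnew, hmis, hfr, hcong, hΛ⟩ := (hA ni _).1 (anti hn₁i hx)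
      exact Or.inr ⟨hM, R, φ, hR, hrat, hsq, hcop, hnew, hmis, hfr, hcong, hΛ⟩
  -- (2) every member of `A n₁` dies at some depth (K, given modularity)
  have hdie : ∀ x ∈ A n₁, ∃ n : ℕ, x ∉ A n := by
    rintro ⟨M, g⟩ hx
    obtain ⟨hM, R, φ, hR, -, -, hnew, hmis, -, -, -⟩ := (hA n₁ _).1 hx
    haveI := hM
    obtain ⟨n, hn⟩ := stub_depthRigidity hMod W p M g hnew hmis
    refine ⟨n, fun hx' ↦ ?_⟩
    obtain ⟨_, R', φ', hR', -, -, -, -, -, hcong', -⟩ := (hA n _).1 hx'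
    exact hn R' φ' hR' hcong'
  choose! f hf using hdie
  -- (3) the uniform depth: beyond `n₁` and every death depth of the finitely many members of `A n₁`
  refine ⟨max n₁ (hfin.toFinset.sup f), fun n hn ↦ ?_⟩
  rintro ⟨M, hM, g, R, φ, hR, hrest⟩
  have hx : (⟨M, g⟩ : Σ M : ℕ, CuspForm (CongruenceSubgroup.Gamma0 (W.conductorNorm ℤ * M)) 2) ∈ A n :=
    (hA n _).2 ⟨hM, R, φ, hR, hrest⟩
  have hx₁ : (⟨M, g⟩ : Σ M : ℕ, CuspForm (CongruenceSubgroup.Gamma0 (W.conductorNorm ℤ * M)) 2) ∈ A n₁ :=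
    anti ((le_max_left _ _).trans hn) hx
  have hle : f ⟨M, g⟩ ≤ n :=
    (Finset.le_sup (f := f) (hfin.mem_toFinset.mpr hx₁)).trans ((le_max_right _ _).trans hn)
  exact hf _ hx₁ (anti hle hx)

/-- **The compactness cut, named for citation**: `IsolationOfAccidentalZeros` follows from modularity,
the Eichler–Shimura construction, the finiteness of deep congruences to a fixed elliptic curve, and the
finiteness at one depth of the irrational shadows (alias of `stub_transfer`). [folklore] -/
theorem isolationOfAccidentalZeros_of_irrationalShadowsFinite (hMod : exists_isNewformOf)
    (hES : eichlerShimuraConstruction) (hDC : DeepCongruenceFinite)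
    (hFi : ∀ (W : WeierstrassCurve ℚ) [W.IsElliptic] [W.IsGloballyMinimal] (p : ℕ) [Fact p.Prime],
      5 ≤ p → W.HasGoodReductionAtPrime p → ¬ (p : ℤ) ∣ W.frobeniusTrace p →
      W.HasIrreducibleModPGaloisRep p →
      ∃ n : ℕ, Set.Finite {x : Σ M : ℕ, CuspForm (CongruenceSubgroup.Gamma0 (W.conductorNorm ℤ * M)) 2 |
        ∃ (_ : NeZero (W.conductorNorm ℤ * x.1)) (R : Subring ℂ) (φ : R →+* ZMod (p ^ n)) (hR : ∀ ℓ : ℕ, ℓ.Prime → ¬ ℓ ∣ W.conductorNorm ℤ * x.1 → heckeEigenvalue x.2 ℓ ∈ R), ¬ (∀ m : ℕ, ∃ a : ℤ, (qExpansion 1 ⇑(x.2)).coeff m = (a : ℂ)) ∧ Squarefree x.1 ∧ Nat.Coprime x.1 (p * W.conductorNorm ℤ) ∧ IsNewform0 x.2 ∧ (∃ m : ℕ, (qExpansion 1 ⇑(x.2)).coeff m ≠ ((W.LFunction m : ℤ) : ℂ)) ∧ cuspHeckeOperatorₗ (CongruenceSubgroup.Gamma0 (W.conductorNorm ℤ *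 x.1)) 2 (slToGLPos ModularGroup.S * diagGL ((W.conductorNorm ℤ * x.1 : ℕ) : ℚ) 1 (Nat.cast_pos.mpr (NeZero.pos (W.conductorNorm ℤ * x.1))) one_pos) x.2 = -(x.2) ∧ (∀ (ℓ : ℕ) (hℓ : ℓ.Prime) (hℓL : ¬ ℓ ∣ W.conductorNorm ℤ * x.1), φ ⟨heckeEigenvalue x.2 ℓ, hR ℓ hℓ hℓL⟩ = ((W.frobeniusTrace ℓ : ℤ) : ZMod (p ^ n))) ∧ ∃ Λ : ℂ → ℂ, Differentiable ℂ Λ ∧ (∀ s : ℂ, 2 < s.re → Λ s = LSeries (fun m ↦ (qExpansion 1 ⇑(x.2)).coeff m) s) ∧ Λ 1 = 0}) :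
    Summit.BirchSwinnertonDyer.BirchSwinnertonDyer.Theses.ShadowIsolation.IsolationOfAccidentalZeros :=
  stub_transfer hMod hES hDC hFi

end Summit.BirchSwinnertonDyer.BirchSwinnertonDyer.Theorems

end
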